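import Summits.BirchSwinnertonDyer.BirchSwinnertonDyer.Theorems.AdditiveKolyvaginRoadLagrangianSwitchAtP

/-! # Sketch — crux idea `theta-cycle-seed` on KS′ (`LevelKolyvaginSystemsAdditive`, item stmt-BirchSwinnertonDyer-21396)

First checkable statement of the line THETA-CYCLE SEED (read the residual BDP `p`-adic `L`-function of the additive frame `E`
at the ORDINARY vertex of the θ-cycle of `ρ̄_E`). The E-side first lemma is the BOTTOM SWITCH: at a rank-one frame whose
Mordell–Weil generator is `p`-primitive locally at both places above the split `p`, the residual (relaxed at `𝔭`, strict at
`𝔭̄`) Selmer group of `E[p]` over `K` VANISHES. Nothing is proved here; the `def … : Prop` only has to ELABORATE over existing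
declarations (crux-ideate protocol). BSD is not proved by any of this. -/

set_option linter.dupNamespace false

noncomputable section

open scoped Classical NumberField
open Function NumberField IsDedekindDomain Field WeierstrassCurve
open Literature.NumberTheory.EllipticCurves
open Literature.NumberTheory.GaloisRepresentations Literature.NumberTheory.GaloisRepresentations.DiscreteGaloisModule
  Literature.NumberTheory.GaloisCohomology
open Summit.BirchSwinnertonDyer.Rank1Residual.X11b.FiniteDuality
open Summit.BirchSwinnertonDyer.Rank1Residual.X11b.Relaxation
open Summit.BirchSwinnertonDyer.Rank1Residual.X11b.LocBridge
open Summit.BirchSwinnertonDyer.Rank1Residual.X11b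
open Summit.BirchSwinnertonDyer.Rank1Residual.X11b.KummerPT

namespace Summit.BirchSwinnertonDyer.BirchSwinnertonDyer.Cruxes.LevelKolyvaginSystemsAdditive.ThetaCycleSeed

/-- (T4) **BOTTOM SWITCH — the residual BDP Selmer group dies at a locally primitive rank-one frame.**
`E = W` an elliptic curve over a number field `K`, `p ≠ 2`, the Poitou–Tate package DUAL.2 of the route
(`poitouTate_selmerStructure_duality K`), two DISTINCT finite places `𝔭 ≠ 𝔭'` (meant: the two primes above a split `p` of an
imaginary quadratic `K`) at each of which `H¹(K_v, E[p])` is a PLANE (`#H¹ = p²`; at `v ∣ p` this is `E(K_v)[p] = 0`, the §4 binder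
of TRIAGE-r1-2, by `natCard_localH1_eq_sq`). HYPOTHESES on the frame: the `p`-Selmer group `H¹_𝓚(K, E[p])` has order `p`
(⟸ `dim_𝔽p Sel_p(E/K) = 1`) and its localisation is INJECTIVE at `𝔭` and at `𝔭'` (⟸ the Mordell–Weil generator is not
`p`-divisible in `E(K_𝔭)`, `E(K_𝔭')` — the `H_loc` locus; for a base change from `ℚ` the two conditions coincide).
CONCLUSION: the Selmer group of `𝓚[𝔭 ↦ ⊤][𝔭' ↦ ⊥]` (E's Kummer conditions off `p`, RELAXED at `𝔭`, STRICT at `𝔭'` — the residual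
shadow of Castella 2018 Def. 2.2 ∕ JSW `Sel_{∅,0}`, `Castella2018.AcSelmer.selmerOver` at the bottom layer) is TRIVIAL.
Meant proof (M-sized, from the tree's jump `relIndex_kummerStrict_kummerRelaxed_sq` at `𝔭`): `strict_𝔭 ⊊ H¹_𝓚 = relaxed_𝔭`
because `loc_𝔭` does not kill the generator and `[relaxed_𝔭 : strict_𝔭] = p`; then `Sel_{rel 𝔭, str 𝔭'} = ker (loc_{𝔭'} on H¹_𝓚) = 0`.
This is the mod-`p` form of Jetchev–Skinner–Wan's `#Sel_{∅,0} = #Ш · [E(K_𝔭̄) : loc E(K)]²` at `Ш[p] = 0`.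
[cite: JetchevSkinnerWan2017, (3.5.d)] [cite: Castella2018, Def. 2.2] [cite: MilneADT2006, Ch. I, Thm. 4.10] -/
def BdpSwitchAtBottom : Prop :=
  ∀ (K : Type) [Field K] [NumberField K] (W : WeierstrassCurve K) [W.IsElliptic] (p : ℕ) [Fact p.Prime]
    (𝔭 𝔭' : HeightOneSpectrum (𝓞 K)),
    p ≠ 2 → poitouTate_selmerStructure_duality K → 𝔭 ≠ 𝔭' →
    Nat.card (galoisCohomology ((W.torsionGaloisModule ((p ^ 1 : ℕ) : ℤ)).toLocal (Sum.inr 𝔭 : Place K)) 1) = p ^ 2 →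
    Nat.card (galoisCohomology ((W.torsionGaloisModule ((p ^ 1 : ℕ) : ℤ)).toLocal (Sum.inr 𝔭' : Place K)) 1) = p ^ 2 →
    Nat.card (W.kummerSelmerStructure ((p ^ 1 : ℕ) : ℤ)).selmerGroup = p →
    (∀ x ∈ (W.kummerSelmerStructure ((p ^ 1 : ℕ) : ℤ)).selmerGroup,
      galoisCohomology.localization (W.torsionGaloisModule ((p ^ 1 : ℕ) : ℤ)) (Sum.inr 𝔭 : Place K) 1 x = 0 → x = 0) →
    (∀ x ∈ (W.kummerSelmerStructure ((p ^ 1 : ℕ) : ℤ)).selmerGroup,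
      galoisCohomology.localization (W.torsionGaloisModule ((p ^ 1 : ℕ) : ℤ)) (Sum.inr 𝔭' : Place K) 1 x = 0 → x = 0) →
    Nat.card (SelmerStructure.selmerGroup
      (Function.update (Function.update (W.kummerSelmerStructure ((p ^ 1 : ℕ) : ℤ)) (Sum.inr 𝔭 : Place K) ⊤)
        (Sum.inr 𝔭' : Place K) ⊥ : SelmerStructure (W.torsionGaloisModule ((p ^ 1 : ℕ) : ℤ)))) = 1

/-- (T-pin) **Unit transport along a mod-`p` congruence** — the one-line algebra under the θ-cycle log identity (T1): in any
commutative ring in which `p` lies in the Jacobson radical (meant: `ℤ_p^{ur}`, or `𝒪_𝔭` of the Hecke field), if `x − u·y ∈ (p)`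
with `u` a unit (`x` = `log_{ω_E}(y_K)/c`, `y` = the CM-value sum of `θ^j h^{[p]}` over `Pic 𝒪_K`, `u` = the Euler factors at
the primes where the two Selmer structures differ), then `x` is a unit iff `y` is. -/
def UnitTransportModP : Prop :=
  ∀ (R : Type) [CommRing R] (p : R), p ∈ Ideal.jacobson (⊥ : Ideal R) →
    ∀ (x y u : R), IsUnit u → x - u * y ∈ Ideal.span {p} → (IsUnit x ↔ IsUnit y)

end Summit.BirchSwinnertonDyer.BirchSwinnertonDyer.Cruxes.LevelKolyvaginSystemsAdditive.ThetaCycleSeed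

end
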